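import Summits.QuantumFields.YangMills.Theorems.SqueezedSkewnessTorusKLStubMixedParseval
import Summits.QuantumFields.YangMills.Theorems.SqueezedSkewnessTorusKLTorusMixture
import Summits.QuantumFields.YangMills.Theorems.SqueezedSkewnessTorusKLTransport
import Summits.QuantumFields.YangMills.Theorems.SqueezedSkewnessTorusKLWindow
import Mathlib.MeasureTheory.Measure.SeparableMeasure
import HarnessLib

/-!
# Route `SqueezedSkewness`, crux `TorusKL` (stmt-QuantumFields-23204): THE REGISTERED STUB `stub_torusMixtureData` AND THE CRUX

★ `stub_torusMixtureData : SqueezedSkewnessTorusKLStub.__Registered.stub_torusMixtureData` — the torus OS / transfer-operator datum of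
the site reflection on the finite-period torus as a thermal mixture on `ℓ²(ℕ, ℂ)` (ENGINE-KL, layers K2–K5 of `…TorusKL*`): for `T ≥ 5`
the finite-period Källén–Lehmann mixture `exists_torus_mixture` on `L²(slices; ℂ)` is transported to `ℓ²(ℕ, ℂ)` (`Transport`) and the
lattice window `x : ℤ⁴ ↦ (t, q)` is book-kept (`Window`); for `T ≤ 4` the support window `0 < x₀`, `2x₀ + 3 ≤ T` is empty and the datum is
trivial.  ★ `TorusKL_proof : TorusKL` — the crux BY NAME, from the landed composition `SqueezedSkewnessTorusKLStub.torusKL_of_torusMixtureData`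
(w2) and this stub.  Seat `ym-line-fcl-p3` g16.  HONEST FRAMING: `TorusKL` is a finite-volume lattice identity (transfer matrix + site
reflection positivity in Källén–Lehmann form); nothing about NT, a continuum limit or the mass gap is proved here.
References: M. Lüscher, Comm. Math. Phys. 54 (1977) 283; I. Montvay, G. Münster, *Quantum Fields on a Lattice* (1994) §3.2.6;
M. Reed, B. Simon, *Methods of Modern Mathematical Physics I* (1980) [cite: Luscher1977] [cite: MontvayMunster1994, §3.2.6 (3.145)]
[cite: ReedSimonI1980, Thm II.7].
-/

set_option autoImplicit false

noncomputable section

open MeasureTheory Filter Function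
open scoped InnerProductSpace ComplexConjugate ENNReal BigOperators
open Literature.MathematicalPhysics.QuantumFieldTheory Literature.Barriers.QuantumFields Literature.MathematicalPhysics.QuantumLattice

namespace Summit.QuantumFields.YangMills.Theorems.TorusKL

set_option synthInstance.maxHeartbeats 200000 in
set_option maxHeartbeats 1600000 in
/-- **The torus mixture datum, explicit form** (the registered statement with its `let`s unfolded): trivial datum for `T ≤ 4`, the transported
finite-period Källén–Lehmann mixture for `T ≥ 5`. [cite: Luscher1977] [cite: MontvayMunster1994, §3.2.6 (3.145)] -/
theorem torusMixtureData_explicit {G : Type} [Group G] [TopologicalSpace G] [IsTopologicalGroup G] [CompactSpace G] [MeasurableSpace G]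
    [BorelSpace G] [SecondCountableTopology G] (r : LatticeRep G) {β : ℝ} {L T : ℕ} {s : ℝ} (hβ : 0 ≤ β) (hT : 1 ≤ T) (hs : 0 < s) :
    ∃ (p : ℕ → ℝ) (W₀ : ℝ) (P : ℕ → (lp (fun _ : ℕ => ℂ) 2 →L[ℂ] lp (fun _ : ℕ => ℂ) 2))
      (U : ℕ → (Fin 3 → ℤ) → (lp (fun _ : ℕ => ℂ) 2 →L[ℂ] lp (fun _ : ℕ => ℂ) 2)) (ψ : ℕ → lp (fun _ : ℕ => ℂ) 2),
      (∀ i, 0 ≤ p i) ∧ 0 ≤ W₀ ∧ (∀ i : ℕ, IsSelfAdjoint (P i) ∧ IsCompactOperator (P i) ∧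
        (∀ v : lp (fun _ : ℕ => ℂ) 2, 0 ≤ RCLike.re (inner ℂ (P i v) v)) ∧ U i 0 = 1 ∧ (∀ x y : Fin 3 → ℤ, U i (x + y) = U i x * U i y) ∧
        (∀ x y : Fin 3 → ℤ, (∀ k, ((x k : ℤ) : ZMod (2 * L + 1)) = ((y k : ℤ) : ZMod (2 * L + 1))) → U i x = U i y) ∧
        (∀ (x : Fin 3 → ℤ) (v : lp (fun _ : ℕ => ℂ) 2), ‖U i x v‖ = ‖v‖) ∧ (∀ x : Fin 3 → ℤ, P i * U i x = U i x * P i)) ∧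
      ∀ (H : ℝ) (f : SchwartzMap (EuclideanSpace ℝ (Fin 4)) ℝ), 2 * H + 3 * s ≤ s * T →
        tsupport (f : EuclideanSpace ℝ (Fin 4) → ℝ) ⊆ {y : EuclideanSpace ℝ (Fin 4) | 0 < y 0 ∧ y 0 ≤ H} →
        tsupport (f : EuclideanSpace ℝ (Fin 4) → ℝ) ⊆ {y : EuclideanSpace ℝ (Fin 4) | ∀ i : Fin 3, |y i.succ| < s * (L + 1 / 2)} →
        HasSum (fun i : ℕ => p i * ‖(∑' x : Fin 4 → ℤ, ((f (s • siteToE (d := 4) x) : ℝ) : ℂ) •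
            ((P i ^ (Int.toNat (x 0 - 1))) ((U i (fun k : Fin 3 => x k.succ)) (ψ i))))‖ ^ 2)
          ((∫ U : FinTorusSite (2 * L + 1) (2 * L + 1) (2 * L + 1) T × Fin 4 → G,
            (∑ x : FinTorusSite (2 * L + 1) (2 * L + 1) (2 * L + 1) T, f (s • siteToE (d := 4) ![(if 2 * x.2.2.2.val < T then (x.2.2.2.val : ℤ) else (x.2.2.2.val : ℤ) - ((T : ℕ) : ℤ)), (if 2 * x.1.val < 2 * L + 1 then (x.1.val : ℤ) else (x.1.val : ℤ) - ((2 * L + 1 : ℕ) : ℤ)), (if 2 * x.2.1.val < 2 * L + 1 then (x.2.1.val : ℤ) else (x.2.1.val : ℤ) - ((2 * L + 1 : ℕ) : ℤ)), (if 2 * x.2.2.1.val < 2 * L + 1 then (x.2.2.1.val : ℤ) else (x.2.2.1.val : ℤ) - ((2 * L + 1 : ℕ) : ℤ))]) *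
              ∑ q : {q : Fin 4 × Fin 4 // q.1 < q.2}, (r.ρ (finTorusPlaquette (fun e : FinTorusSite (2 * L + 1) (2 * L + 1) (2 * L + 1) T × Fin 4 => if e.2 = Fin.last 3 then (U ((e.1.1, e.1.2.1, e.1.2.2.1, Fin.rev e.1.2.2.2), Fin.last 3))⁻¹ else U ((e.1.1, e.1.2.1, e.1.2.2.1, ⟨(T - e.1.2.2.2.val) % T, Nat.mod_lt _ e.1.2.2.2.pos⟩), e.2)) x q.1.1 q.1.2)).trace.re) *
            (∑ x : FinTorusSite (2 * L + 1) (2 * L + 1) (2 * L + 1) T, f (s • siteToE (d := 4) ![(if 2 * x.2.2.2.val < T then (x.2.2.2.val : ℤ) else (x.2.2.2.val : ℤ) - ((T : ℕ) : ℤ)), (if 2 * x.1.val < 2 * L + 1 then (x.1.val : ℤ) else (x.1.val : ℤ) - ((2 * L + 1 : ℕ) : ℤ)), (if 2 * x.2.1.val < 2 * L + 1 then (x.2.1.val : ℤ) else (x.2.1.val : ℤ) - ((2 * L + 1 : ℕ) : ℤ)), (if 2 * x.2.2.1.val < 2 * L + 1 then (x.2.2.1.val : ℤ) else (x.2.2.1.val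 : ℤ) - ((2 * L + 1 : ℕ) : ℤ))]) *
              ∑ q : {q : Fin 4 × Fin 4 // q.1 < q.2}, (r.ρ (finTorusPlaquette U x q.1.1 q.1.2)).trace.re) *
            Real.exp (-β * ∑ x : FinTorusSite (2 * L + 1) (2 * L + 1) (2 * L + 1) T, ∑ q : {q : Fin 4 × Fin 4 // q.1 < q.2},
              ((r.N : ℝ) - (r.ρ (finTorusPlaquette U x q.1.1 q.1.2)).trace.re)) ∂MeasureTheory.Measure.pi (fun _ : FinTorusSite (2 * L + 1) (2 * L + 1) (2 * L + 1) T × Fin 4 => haarProbability G)) /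
            wilsonFinTorusPartition r.ρ β (2 * L + 1) (2 * L + 1) (2 * L + 1) T -
          (∫ U : FinTorusSite (2 * L + 1) (2 * L + 1) (2 * L + 1) T × Fin 4 → G,
            (∑ x : FinTorusSite (2 * L + 1) (2 * L + 1) (2 * L + 1) T, f (s • siteToE (d := 4) ![(if 2 * x.2.2.2.val < T then (x.2.2.2.val : ℤ) else (x.2.2.2.val : ℤ) - ((T : ℕ) : ℤ)), (if 2 * x.1.val < 2 * L + 1 then (x.1.val : ℤ) else (x.1.val : ℤ) - ((2 * L + 1 : ℕ) : ℤ)), (if 2 * x.2.1.val < 2 * L + 1 then (x.2.1.val : ℤ) else (x.2.1.val : ℤ) - ((2 * L + 1 : ℕ) : ℤ)), (if 2 * x.2.2.1.val < 2 * L + 1 then (x.2.2.1.val : ℤ) else (x.2.2.1.val : ℤ) - ((2 * L + 1 : ℕ) : ℤ))]) *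
              ∑ q : {q : Fin 4 × Fin 4 // q.1 < q.2}, (r.ρ (finTorusPlaquette (fun e : FinTorusSite (2 * L + 1) (2 * L + 1) (2 * L + 1) T × Fin 4 => if e.2 = Fin.last 3 then (U ((e.1.1, e.1.2.1, e.1.2.2.1, Fin.rev e.1.2.2.2), Fin.last 3))⁻¹ else U ((e.1.1, e.1.2.1, e.1.2.2.1, ⟨(T - e.1.2.2.2.val) % T, Nat.mod_lt _ e.1.2.2.2.pos⟩), e.2)) x q.1.1 q.1.2)).trace.re) *
            Real.exp (-β * ∑ x : FinTorusSite (2 * L + 1) (2 * L + 1) (2 * L + 1) T, ∑ q : {q : Fin 4 × Fin 4 // q.1 < q.2},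
              ((r.N : ℝ) - (r.ρ (finTorusPlaquette U x q.1.1 q.1.2)).trace.re)) ∂MeasureTheory.Measure.pi (fun _ : FinTorusSite (2 * L + 1) (2 * L + 1) (2 * L + 1) T × Fin 4 => haarProbability G)) /
            wilsonFinTorusPartition r.ρ β (2 * L + 1) (2 * L + 1) (2 * L + 1) T *
          ((∫ U : FinTorusSite (2 * L + 1) (2 * L + 1) (2 * L + 1) T × Fin 4 → G,
            (∑ x : FinTorusSite (2 * L + 1) (2 * L + 1) (2 * L + 1) T, f (s • siteToE (d := 4) ![(if 2 * x.2.2.2.val < T then (x.2.2.2.val : ℤ) else (x.2.2.2.val : ℤ) - ((T : ℕ) : ℤ)), (if 2 * x.1.val < 2 * L + 1 then (x.1.val : ℤ) else (x.1.val : ℤ) - ((2 * L + 1 : ℕ) : ℤ)), (if 2 * x.2.1.val < 2 * L + 1 then (x.2.1.val : ℤ) else (x.2.1.val : ℤ) - ((2 * L + 1 : ℕ) : ℤ)), (if 2 * x.2.2.1.val < 2 * L + 1 then (x.2.2.1.val : ℤ) else (x.2.2.1.val : ℤ) - ((2 * L + 1 : ℕ) : ℤ))]) *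
              ∑ q : {q : Fin 4 × Fin 4 // q.1 < q.2}, (r.ρ (finTorusPlaquette U x q.1.1 q.1.2)).trace.re) *
            Real.exp (-β * ∑ x : FinTorusSite (2 * L + 1) (2 * L + 1) (2 * L + 1) T, ∑ q : {q : Fin 4 × Fin 4 // q.1 < q.2},
              ((r.N : ℝ) - (r.ρ (finTorusPlaquette U x q.1.1 q.1.2)).trace.re)) ∂MeasureTheory.Measure.pi (fun _ : FinTorusSite (2 * L + 1) (2 * L + 1) (2 * L + 1) T × Fin 4 => haarProbability G)) /
            wilsonFinTorusPartition r.ρ β (2 * L + 1) (2 * L + 1) (2 * L + 1) T) -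
          W₀ * (∑' x : Fin 4 → ℤ, f (s • siteToE (d := 4) x)) ^ 2) := by
  classical
  by_cases hT4 : T ≤ 4
  · -- the window `1 ≤ x₀`, `2 x₀ + 3 ≤ T` is empty: every coefficient vanishes and the trivial datum does it
    refine ⟨fun _ => 0, 0, fun _ => 0, fun _ _ => 1, fun _ => 0, fun _ => le_rfl, le_rfl, fun i => ⟨IsSelfAdjoint.zero _,
      isCompactOperator_zero,
      fun v => by simp, rfl, fun _ _ => (mul_one _).symm, fun _ _ _ => rfl,
      fun _ v => by rw [one_apply_eq_self], fun _ => by rw [zero_mul, mul_zero]⟩, fun H f hHT hf1 hf2 => ?_⟩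
    have hz : ∀ x : Fin 4 → ℤ, f (s • siteToE (d := 4) x) = 0 := by
      intro x; by_contra hne
      obtain ⟨h1, -, h3, -⟩ := Window.window_of_ne_zero hs hHT hf1 hf2 x hne
      omega
    simp only [hz, zero_mul, Finset.sum_const_zero, MeasureTheory.integral_zero, zero_div, mul_zero, sub_zero, tsum_zero]
    exact hasSum_zero
  · -- `T = K + 1 ≥ 5`
    obtain ⟨K, rfl⟩ : ∃ K, T = K + 1 := ⟨T - 1, by omega⟩
    have hK : 4 ≤ K := by omega
    haveI : Fact ((2 : ℝ≥0∞) ≠ ⊤) := ⟨ENNReal.ofNat_ne_top⟩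
    haveI : MeasurableSpace.CountablyGenerated (FinSpatialSite (2 * L + 1) (2 * L + 1) (2 * L + 1) × Fin 3 → G) := inferInstance
    haveI : IsSeparable (Measure.pi fun _ : FinSpatialSite (2 * L + 1) (2 * L + 1) (2 * L + 1) × Fin 3 => haarProbability G) :=
      inferInstance
    haveI : SecondCountableTopology (Lp ℂ 2 (Measure.pi fun _ : FinSpatialSite (2 * L + 1) (2 * L + 1) (2 * L + 1) × Fin 3 =>
      haarProbability G)) := Lp.SecondCountableTopology
    obtain ⟨κ, hκc, pw, W₀, Pκ, Uκ, ψκ, hpw, hW₀, hDκ, hmixκ⟩ :=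
      exists_torus_mixture (S := 2 * L + 1) r.ρ β r.continuous r.mem_unitary hβ hK
    haveI : Countable κ := hκc
    obtain ⟨J⟩ := Transport.nonempty_linearIsometry_l2
      (H := Lp ℂ 2 (Measure.pi fun _ : FinSpatialSite (2 * L + 1) (2 * L + 1) (2 * L + 1) × Fin 3 => haarProbability G))
    have hTr := fun k => Transport.transport J (Pκ k) (Uκ k) (hDκ k).1 (hDκ k).2.1 (hDκ k).2.2.1 (hDκ k).2.2.2.1 (hDκ k).2.2.2.2.1
      (hDκ k).2.2.2.2.2.1 (hDκ k).2.2.2.2.2.2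
    choose P' U' hsa hc hpos h0 hadd hnorm hcomm hid using hTr
    obtain ⟨p, Pn, Un, ψn, hp, hgood, hsumN⟩ := Transport.exists_nat_reindex pw P' U' (fun k => J (ψκ k))
      (fun (Pop : lp (fun _ : ℕ => ℂ) 2 →L[ℂ] lp (fun _ : ℕ => ℂ) 2) (Uop : (Fin 3 → ZMod (2 * L + 1)) → lp (fun _ : ℕ => ℂ) 2 →L[ℂ] lp (fun _ : ℕ => ℂ) 2) =>
        IsSelfAdjoint Pop ∧ IsCompactOperator Pop ∧ (∀ v, 0 ≤ RCLike.re ⟪Pop v, v⟫_ℂ) ∧ Uop 0 = 1 ∧ (∀ x y, Uop (x + y) = Uop x * Uop y) ∧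
          (∀ x v, ‖Uop x v‖ = ‖v‖) ∧ (∀ x, Pop * Uop x = Uop x * Pop))
      0 (fun _ => 1) 0 ⟨IsSelfAdjoint.zero _, isCompactOperator_zero,
        fun v => by simp, rfl, fun _ _ => (mul_one _).symm,
        fun _ v => by rw [one_apply_eq_self], fun _ => by rw [zero_mul, mul_zero]⟩
      hpw (fun k => ⟨hsa k, hc k, hpos k, h0 k, hadd k, hnorm k, hcomm k⟩)
    refine ⟨p, W₀, Pn, fun i x => Un i (fun k => ((x k : ℤ) : ZMod (2 * L + 1))), ψn, hp, hW₀, fun i => ?_, fun H f hHT hf1 hf2 => ?_⟩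
    · obtain ⟨h1, h2, h3, h4, h5, h6, h7⟩ := hgood i
      refine ⟨h1, h2, h3, ?_, fun x y => ?_, fun x y hxy => ?_, fun x v => h6 _ v, fun x => h7 _⟩
      · show Un i (fun k => (((0 : Fin 3 → ℤ) k : ℤ) : ZMod (2 * L + 1))) = 1
        have e : (fun k : Fin 3 => (((0 : Fin 3 → ℤ) k : ℤ) : ZMod (2 * L + 1))) = 0 := funext fun k => by simp
        rw [e]; exact h4
      · show Un i (fun k => (((x + y) k : ℤ) : ZMod (2 * L + 1))) =
          Un i (fun k => ((x k : ℤ) : ZMod (2 * L + 1))) * Un i (fun k => ((y k : ℤ) : ZMod (2 * L + 1)))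
        have e : (fun k : Fin 3 => (((x + y) k : ℤ) : ZMod (2 * L + 1))) =
            (fun k => ((x k : ℤ) : ZMod (2 * L + 1))) + fun k => ((y k : ℤ) : ZMod (2 * L + 1)) := funext fun k => by simp
        rw [e]; exact h5 _ _
      · show Un i (fun k => ((x k : ℤ) : ZMod (2 * L + 1))) = Un i (fun k => ((y k : ℤ) : ZMod (2 * L + 1)))
        rw [show (fun k : Fin 3 => ((x k : ℤ) : ZMod (2 * L + 1))) = fun k => ((y k : ℤ) : ZMod (2 * L + 1)) from funext hxy]
    · -- the centred coordinate and the coefficient function of the window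
      obtain ⟨cc, hcc⟩ : ∃ cc : (n : ℕ) → Fin n → ℤ,
          cc = fun (n : ℕ) (i : Fin n) => if 2 * i.val < n then (i.val : ℤ) else (i.val : ℤ) - n := ⟨_, rfl⟩
      have hcc' : ∀ (n : ℕ) (i : Fin n), (if 2 * i.val < n then (i.val : ℤ) else (i.val : ℤ) - n) = cc n i := fun n i => by rw [hcc]
      simp only [hcc']
      obtain ⟨cf, hcf⟩ : ∃ cf : Fin (K + 1) → FinSpatialSite (2 * L + 1) (2 * L + 1) (2 * L + 1) → ℝ, cf = fun t q =>
          f (s • siteToE (d := 4) ![cc (K + 1) t, cc (2 * L + 1) q.1, cc (2 * L + 1) q.2.1, cc (2 * L + 1) q.2.2]) := ⟨_, rfl⟩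
      have hcf' : ∀ t q, f (s • siteToE (d := 4) ![cc (K + 1) t, cc (2 * L + 1) q.1, cc (2 * L + 1) q.2.1, cc (2 * L + 1) q.2.2]) = cf t q :=
        fun t q => by rw [hcf]
      -- the window
      have hwin : ∀ t q, cf t q ≠ 0 → 2 * t.val < K + 1 ∧ 1 ≤ t.val ∧ (t.val : ℝ) ≤ H / s := by
        intro t q hne
        rw [← hcf'] at hne
        obtain ⟨h1, h2, -, -⟩ := Window.window_of_ne_zero hs hHT hf1 hf2 _ hne
        simp only [Matrix.cons_val_zero, hcc] at h1 h2
        by_cases h2t : 2 * t.val < K + 1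
        · simp only [h2t, if_true, Int.cast_natCast] at h1 h2
          exact ⟨h2t, by exact_mod_cast h1, h2⟩
        · simp only [h2t, if_false] at h1; omega
      obtain ⟨h, hh_def⟩ : ∃ h : ℕ, h = ⌊H / s⌋₊ := ⟨_, rfl⟩
      have hh : 2 * h + 3 ≤ K + 1 := by
        by_cases hHs : 0 ≤ H / s
        · have e1 : (h : ℝ) ≤ H / s := hh_def ▸ Nat.floor_le hHs
          have e2 : 2 * (H / s) + 3 ≤ (K : ℝ) + 1 := by
            have hs0 : s ≠ 0 := hs.ne'
            have h' : 2 * H + 3 * s ≤ s * ((K : ℝ) + 1) := by push_cast at hHT; exact hHT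
            rw [← sub_nonneg] at h' ⊢
            have e4 : (K : ℝ) + 1 - (2 * (H / s) + 3) = (s * ((K : ℝ) + 1) - (2 * H + 3 * s)) / s := by field_simp
            rw [e4]; exact div_nonneg h' hs.le
          have e3 : (2 * h + 3 : ℝ) ≤ K + 1 := by linarith
          exact_mod_cast e3
        · have e0 : h = 0 := hh_def ▸ Nat.floor_of_nonpos (le_of_lt (not_le.1 hHs))
          omega
      have hcf0 : ∀ (t : Fin (K + 1)) q, ¬ (1 ≤ (t : ℕ) ∧ (t : ℕ) ≤ h) → cf t q = 0 := by
        intro t q hn; by_contra hne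
        obtain ⟨-, h1, h2⟩ := hwin t q hne
        exact hn ⟨h1, hh_def ▸ Nat.le_floor h2⟩
      -- the finite-period Källén–Lehmann mixture for these coefficients, transported to `ℓ²(ℕ, ℂ)` and re-indexed by `ℕ`
      have key := hmixκ h hh cf hcf0
      have hF : ∀ k, ‖∑ t : Fin (K + 1), ∑ q : FinSpatialSite (2 * L + 1) (2 * L + 1) (2 * L + 1), (cf t q : ℂ) •
          ((P' k ^ ((t : ℕ) - 1)) (U' k ![ZMod.finEquiv (2 * L + 1) q.1, ZMod.finEquiv (2 * L + 1) q.2.1, ZMod.finEquiv (2 * L + 1) q.2.2] (J (ψκ k))))‖ =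
          ‖∑ t : Fin (K + 1), ∑ q : FinSpatialSite (2 * L + 1) (2 * L + 1) (2 * L + 1), (cf t q : ℂ) •
          ((Pκ k ^ ((t : ℕ) - 1)) (Uκ k ![ZMod.finEquiv (2 * L + 1) q.1, ZMod.finEquiv (2 * L + 1) q.2.1, ZMod.finEquiv (2 * L + 1) q.2.2] (ψκ k)))‖ := by
        intro k
        have e : (∑ t : Fin (K + 1), ∑ q : FinSpatialSite (2 * L + 1) (2 * L + 1) (2 * L + 1), (cf t q : ℂ) •
            ((P' k ^ ((t : ℕ) - 1)) (U' k ![ZMod.finEquiv (2 * L + 1) q.1, ZMod.finEquiv (2 * L + 1) q.2.1, ZMod.finEquiv (2 * L + 1) q.2.2] (J (ψκ k))))) =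
            J (∑ t : Fin (K + 1), ∑ q : FinSpatialSite (2 * L + 1) (2 * L + 1) (2 * L + 1), (cf t q : ℂ) •
              ((Pκ k ^ ((t : ℕ) - 1)) (Uκ k ![ZMod.finEquiv (2 * L + 1) q.1, ZMod.finEquiv (2 * L + 1) q.2.1, ZMod.finEquiv (2 * L + 1) q.2.2] (ψκ k)))) := by
          rw [map_sum]
          refine Finset.sum_congr rfl fun t _ => ?_
          rw [map_sum]
          refine Finset.sum_congr rfl fun q _ => ?_
          rw [J.map_smul, hid]
        rw [e, J.norm_map]
      have key' := key
      simp only [← hF] at key'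
      have hN := hsumN (fun Pop Uop ψv => ‖∑ t : Fin (K + 1), ∑ q : FinSpatialSite (2 * L + 1) (2 * L + 1) (2 * L + 1), (cf t q : ℂ) •
          ((Pop ^ ((t : ℕ) - 1)) (Uop ![ZMod.finEquiv (2 * L + 1) q.1, ZMod.finEquiv (2 * L + 1) q.2.1, ZMod.finEquiv (2 * L + 1) q.2.2] ψv))‖ ^ 2) _ key'
      -- the lattice points carrying a non-zero coefficient lie in the window, which is the injective image of the torus sites
      have hΦ := Window.window_injective (S := 2 * L + 1) (T := K + 1) cc hcc
      have h0f : ∀ x : Fin 4 → ℤ, x ∉ Set.range (fun pt : Fin (K + 1) × FinSpatialSite (2 * L + 1) (2 * L + 1) (2 * L + 1) =>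
          (![cc (K + 1) pt.1, cc (2 * L + 1) pt.2.1, cc (2 * L + 1) pt.2.2.1, cc (2 * L + 1) pt.2.2.2] : Fin 4 → ℤ)) →
          f (s • siteToE (d := 4) x) = 0 := by
        intro x hx; by_contra hne
        obtain ⟨h1, -, h3, h4⟩ := Window.window_of_ne_zero hs hHT hf1 hf2 x hne
        exact hx (Window.window_range cc hcc x (by omega) (by omega)
          fun k => ⟨by have h5 := (h4 k).1; omega, by have h5 := (h4 k).2; omega⟩)
      have htsf : ∑' x : Fin 4 → ℤ, f (s • siteToE (d := 4) x) = ∑ t : Fin (K + 1), ∑ q : FinSpatialSite (2 * L + 1) (2 * L + 1) (2 * L + 1), cf t q := by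
        rw [Window.tsum_eq_sum_of_support _ hΦ _ h0f, Fintype.sum_prod_type]
        simp only [hcf']
      have hfam : (fun i : ℕ => p i * ‖(∑' x : Fin 4 → ℤ, ((f (s • siteToE (d := 4) x) : ℝ) : ℂ) •
          ((Pn i ^ (Int.toNat (x 0 - 1))) ((Un i (fun k : Fin 3 => ((x k.succ : ℤ) : ZMod (2 * L + 1)))) (ψn i))))‖ ^ 2) =
          fun i => p i * ‖∑ t : Fin (K + 1), ∑ q : FinSpatialSite (2 * L + 1) (2 * L + 1) (2 * L + 1), (cf t q : ℂ) •
            ((Pn i ^ ((t : ℕ) - 1)) (Un i ![ZMod.finEquiv (2 * L + 1) q.1, ZMod.finEquiv (2 * L + 1) q.2.1, ZMod.finEquiv (2 * L + 1) q.2.2] (ψn i)))‖ ^ 2 := by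
        funext i
        congr 3
        rw [Window.tsum_eq_sum_of_support _ hΦ _ (fun x hx => by rw [h0f x hx, Complex.ofReal_zero, zero_smul]), Fintype.sum_prod_type]
        refine Finset.sum_congr rfl fun t _ => Finset.sum_congr rfl fun q _ => ?_
        simp only [Matrix.cons_val_zero, Matrix.cons_val_succ, hcf']
        by_cases hcq : cf t q = 0
        · rw [hcq, Complex.ofReal_zero, zero_smul, zero_smul]
        · obtain ⟨h2t, h1t, -⟩ := hwin t q hcq
          have e1 : Int.toNat (cc (K + 1) t - 1) = (t : ℕ) - 1 := by
            have e0 : cc (K + 1) t = (t : ℕ) := by rw [hcc]; exact if_pos h2t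
            rw [e0, show ((t : ℕ) : ℤ) - 1 = (((t : ℕ) - 1 : ℕ) : ℤ) by omega, Int.toNat_natCast]
          have e2 : (fun k : Fin 3 => ((![cc (2 * L + 1) q.1, cc (2 * L + 1) q.2.1, cc (2 * L + 1) q.2.2] k : ℤ) : ZMod (2 * L + 1))) =
              ![ZMod.finEquiv (2 * L + 1) q.1, ZMod.finEquiv (2 * L + 1) q.2.1, ZMod.finEquiv (2 * L + 1) q.2.2] := by
            have hq : ∀ j : Fin (2 * L + 1), ((cc (2 * L + 1) j : ℤ) : ZMod (2 * L + 1)) = ZMod.finEquiv (2 * L + 1) j :=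
              fun j => by rw [hcc]; exact Window.intCast_centered_eq_finEquiv (2 * L + 1) j
            funext k
            fin_cases k <;> simp [hq]
          rw [e1, e2]
      -- the torus sums are window sums
      have hB : ∀ U' : FinTorusSite (2 * L + 1) (2 * L + 1) (2 * L + 1) (K + 1) × Fin 4 → G,
          (∑ x : FinTorusSite (2 * L + 1) (2 * L + 1) (2 * L + 1) (K + 1),
            f (s • siteToE (d := 4) ![cc (K + 1) x.2.2.2, cc (2 * L + 1) x.1, cc (2 * L + 1) x.2.1, cc (2 * L + 1) x.2.2.1]) *
              ∑ q : {q : Fin 4 × Fin 4 // q.1 < q.2}, (r.ρ (finTorusPlaquette U' x q.1.1 q.1.2)).trace.re) =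
          ∑ t : Fin (K + 1), ∑ q : FinSpatialSite (2 * L + 1) (2 * L + 1) (2 * L + 1), cf t q *
            ∑ pl : {q : Fin 4 × Fin 4 // q.1 < q.2}, (r.ρ (finTorusPlaquette U' (q.toSite t) pl.1.1 pl.1.2)).trace.re := by
        intro U'
        rw [Window.sum_finTorusSite_eq_sum_toSite]
        simp only [FinSpatialSite.toSite, hcf']
      simp only [hB, htsf]
      rw [hfam]
      exact hN

set_option maxHeartbeats 800000 in
/-- **The torus mixture datum** in the verbatim `let`-form of the registered stub (instances generic). -/
theorem torusMixtureData_core {G : Type} [Group G] [TopologicalSpace G] [IsTopologicalGroup G] [CompactSpace G] [MeasurableSpace G]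
    [BorelSpace G] [SecondCountableTopology G] (r : Literature.MathematicalPhysics.QuantumFieldTheory.LatticeRep G) :
    let St : ℕ → ℕ → Type := fun S T => Literature.MathematicalPhysics.QuantumFieldTheory.FinTorusSite S S S T; let Cfg : ℕ → ℕ → Type := fun S T => Literature.MathematicalPhysics.QuantumFieldTheory.FinTorusSite S S S T × Fin 4 → G; let cc : (n : ℕ) → Fin n → ℤ := fun n i => if 2 * i.val < n then (i.val : ℤ) else (i.val : ℤ) - n; let posE : (S T : ℕ) → St S T → EuclideanSpace ℝ (Fin 4) := fun S T x => Literature.MathematicalPhysics.QuantumLattice.siteToE (d := 4) ![cc T x.2.2.2, cc S x.1, cc S x.2.1, cc S x.2.2.1]; let P : (S T : ℕ) → St S T → Fin 4 → Fin 4 → Cfg S T → ℝ := fun _ _ x i j U => (r.ρ (Literature.MathematicalPhysics.QuantumFieldTheory.finTorusPlaquette U x i j)).trace.re; let A : (S T : ℕ) → St S T → Cfg S T → ℝ := fun S T x U => ∑ q : {q : Fin 4 × Fin 4 // q.1 < q.2}, P S T x q.1.1 q.1.2 U; let w : ℝ → (S T : ℕ) → Cfg S T → ℝ := fun β S T U =>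 Real.exp (-β * ∑ x : St S T, ∑ q : {q : Fin 4 × Fin 4 // q.1 < q.2}, ((r.N : ℝ) - P S T x q.1.1 q.1.2 U)); let E : ℝ → (S T : ℕ) → (Cfg S T → ℝ) → ℝ := fun β S T F => (∫ U : Literature.MathematicalPhysics.QuantumFieldTheory.FinTorusSite S S S T × Fin 4 → G, F U * w β S T U ∂MeasureTheory.Measure.pi (fun _ => Literature.MathematicalPhysics.QuantumFieldTheory.haarProbability G)) / Literature.MathematicalPhysics.QuantumFieldTheory.wilsonFinTorusPartition r.ρ β S S S T; let Cov : ℝ → (S T : ℕ) → (Cfg S T → ℝ) → (Cfg S T → ℝ) → ℝ := fun β S T F F' => E β S T (fun U => F U * F' U) - E β S T F * E β S T F'; let refl : (S T : ℕ) → Cfg S T → Cfg S T := fun _ T U e => if e.2 = Fin.last 3 then (U ((e.1.1, e.1.2.1, e.1.2.2.1, Fin.rev e.1.2.2.2), Fin.last 3))⁻¹ else U ((e.1.1, e.1.2.1, e.1.2.2.1, ⟨(T - e.1.2.2.2.val) % T, Nat.mod_lt _ e.1.2.2.2.pos⟩), e.2); let B : (S T : ℕ) → ℝ → SchwartzMap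 (EuclideanSpace ℝ (Fin 4)) ℝ → Cfg S T → ℝ := fun S T s f U => ∑ x : St S T, f (s • posE S T x) * A S T x U; let Qrp : ℝ → (S T : ℕ) → ℝ → SchwartzMap (EuclideanSpace ℝ (Fin 4)) ℝ → ℝ := fun β S T s f => Cov β S T (fun U => B S T s f (refl S T U)) (B S T s f); let _amp : ℝ → SchwartzMap (EuclideanSpace ℝ (Fin 4)) ℝ → ℝ → (Fin 3 → ℝ) → ℂ := fun s f μ p => ∑' x : Fin 4 → ℤ, (((f (s • Literature.MathematicalPhysics.QuantumLattice.siteToE (d := 4) x) * μ ^ (Int.toNat (x 0 - 1))) : ℝ) : ℂ) * Complex.exp (Complex.I * ((s * ∑ k : Fin 3, p k * (x k.succ : ℝ) : ℝ) : ℂ)); ∀ (β : ℝ) (L T : ℕ) (s : ℝ), 0 ≤ β → 1 ≤ L → 1 ≤ T → 0 < s → ∃ (p : ℕ → ℝ) (W₀ : ℝ) (P : ℕ → (lp (fun _ : ℕ => ℂ) 2 →L[ℂ] lp (fun _ : ℕ => ℂ) 2)) (U : ℕ → (Fin 3 → ℤ) → (lp (fun _ : ℕ => ℂ) 2 →L[ℂ]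 lp (fun _ : ℕ => ℂ) 2)) (ψ : ℕ → lp (fun _ : ℕ => ℂ) 2), (∀ i, 0 ≤ p i) ∧ 0 ≤ W₀ ∧ (∀ i : ℕ, IsSelfAdjoint (P i) ∧ IsCompactOperator (P i) ∧ (∀ v : lp (fun _ : ℕ => ℂ) 2, 0 ≤ RCLike.re (inner ℂ (P i v) v)) ∧ U i 0 = 1 ∧ (∀ x y : Fin 3 → ℤ, U i (x + y) = U i x * U i y) ∧ (∀ x y : Fin 3 → ℤ, (∀ k, ((x k : ℤ) : ZMod (2 * L + 1)) = ((y k : ℤ) : ZMod (2 * L + 1))) → U i x = U i y) ∧ (∀ (x : Fin 3 → ℤ) (v : lp (fun _ : ℕ => ℂ) 2), ‖U i x v‖ = ‖v‖) ∧ (∀ x : Fin 3 → ℤ, P i * U i x = U i x * P i)) ∧ ∀ (H : ℝ) (f : SchwartzMap (EuclideanSpace ℝ (Fin 4)) ℝ), 2 * H + 3 * s ≤ s * T → tsupport (f : EuclideanSpace ℝ (Fin 4) → ℝ) ⊆ {y : EuclideanSpace ℝ (Fin 4) | 0 < y 0 ∧ y 0 ≤ H} → tsupport (f : EuclideanSpace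 ℝ (Fin 4) → ℝ) ⊆ {y : EuclideanSpace ℝ (Fin 4) | ∀ i : Fin 3, |y i.succ| < s * (L + 1 / 2)} → HasSum (fun i : ℕ => p i * ‖(∑' x : Fin 4 → ℤ, ((f (s • Literature.MathematicalPhysics.QuantumLattice.siteToE (d := 4) x) : ℝ) : ℂ) • ((P i ^ (Int.toNat (x 0 - 1))) ((U i (fun k : Fin 3 => x k.succ)) (ψ i))))‖ ^ 2) (Qrp β (2 * L + 1) T s f - W₀ * (∑' x : Fin 4 → ℤ, f (s • Literature.MathematicalPhysics.QuantumLattice.siteToE (d := 4) x)) ^ 2) := by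
  dsimp only
  intro β L T s hβ _ hT hs
  exact torusMixtureData_explicit r hβ hT hs

/-- ★ **STUB `stub_torusMixtureData` HOLDS** — the registered statement of the birth skeleton `Cruxes/NT/Lines/torus_kl_birth.lean`, by name
(tree copy `SqueezedSkewnessTorusKLStub.__Registered.stub_torusMixtureData`). [cite: Luscher1977] [cite: MontvayMunster1994, §3.2.6 (3.145)] -/
theorem stub_torusMixtureData : SqueezedSkewnessTorusKLStub.__Registered.stub_torusMixtureData := by
  intro G _ _ _ _
  letI : MeasurableSpace G := borel G
  haveI : BorelSpace G := ⟨rfl⟩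
  intro r
  haveI : SecondCountableTopology G := (r.continuous.isClosedEmbedding r.injective).isEmbedding.secondCountableTopology
  exact torusMixtureData_core r

/-- ★★ **THE CRUX `TorusKL` OF ROUTE `SqueezedSkewness` (stmt-QuantumFields-23204), BY NAME**: torus-direct Källén–Lehmann representation of
the reflected two-point function of the plaquette field on the finite-period torus — from the two registered stubs of the birth skeleton
(`stub_mixedParseval`, w2; `stub_torusMixtureData`, this file) through the skeleton's composition. [cite: Luscher1977]
[cite: MontvayMunster1994, §3.2.6 (3.145)] -/
theorem TorusKL_proof : Summit.QuantumFields.YangMills.Theses.SqueezedSkewness.TorusKL :=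
  SqueezedSkewnessTorusKLStub.torusKL_of_torusMixtureData stub_torusMixtureData

end Summit.QuantumFields.YangMills.Theorems.TorusKL

end
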